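import Literature.Analysis.FluidPDE.TaoAveragedSingleScaleRotation
import HarnessLib

/-!
# Tao 2016, §3.2 (3.7) generalised: every closed base triangle is a rotated STANDARD triple in
# the horizontal plane, and the dilation-free single-scale sentence reduces to standard triples

T. Tao, *Finite time blowup for an averaged three-dimensional Navier–Stokes equation*,
J. Amer. Math. Soc. **29** (2016), 601–674 = arXiv:1402.0290v3, §3.2 p. 15 ("we have the freedom
to rotate … each of the `ξⱼ⁰` as we please. We shall select the normalisation (3.7)
`ξ₁⁰ = (0,1,0)`, `ξ₂⁰ = (-1,-1,0)`, `ξ₃⁰ = (1,0,0)`"), Remark 3.5 p. 20. Sequel of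
`TaoAveragedSingleScaleRotation.lean` (covariance of the dilation-free single-scale sentence (3.9)
under a common rotation of the base triple). HONEST FRAMING (cell harvest/h2-tao-ladder, TAO-LADDER
rung M_1 — MODEL statements about Tao's averaged equation): groundwork for the rung-1 crux
`SingleScaleNoDilAt`; without dilations only a common ROTATION of the base triple is available, so
the base triangle can be brought to Tao's plane and first direction but keeps its side lengths.
Nothing here concerns the true Navier–Stokes equations.

* `stdTriple a x y` — the **standard closed triple** `((0,a,0), (-x,-a-y,0), (x,y,0))` in the
  horizontal plane with first vector along Tao's `ξ₁⁰ = (0,1,0)` (Tao's (3.7) is `stdTriple 1 1 0`);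
  `stdTriple_sum` (it closes), `stdTriple_one_one_zero` (`= xi0`);
* `exists_linearIsometryEquiv_stdTriple` — **every closed triple `ξ` with `ξ 0 ≠ 0` is `S ∘ stdTriple
  ‖ξ 0‖ x y` for a linear isometry `S` of `ℝ³` and some `x ≥ 0`, `y`** (an orthonormal frame adapted
  to `ξ 0` and the component of `ξ 2` orthogonal to it);
* `singleScaleAt_isComplexAverageNoDil_of_stdTriple` — hence the dilation-free single-scale
  sentence about `ξ` follows from the same sentence about its standard representative
  (`singleScaleAt_isComplexAverageNoDil_rotate`).

## References

* T. Tao, J. Amer. Math. Soc. 29 (2016), 601–674, arXiv:1402.0290v3, §3.2 (3.7) p. 15, §3.4 (3.9),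
  Remark 3.5 p. 20. Key `Tao2016AveragedNS`.
-/

noncomputable section

open MeasureTheory Set Filter Module
open scoped ENNReal NNReal SchwartzMap RealInnerProductSpace

namespace Literature.Analysis.FluidPDE.Tao2016

/-- Local notation for physical / frequency space `ℝ³`. -/
local notation "ℝ³" => EuclideanSpace ℝ (Fin 3)
/-- Local notation for the complexified range `ℂ³`. -/
local notation "ℂ³" => EuclideanSpace ℂ (Fin 3)

/-! ### The standard triples -/

/-- **The standard closed base triple** with first modulus `a` and third vertex `(x, y)` in the
horizontal plane: `((0,a,0), (-x,-a-y,0), (x,y,0))` — Tao's normalisation (3.7) is the case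
`a = 1, x = 1, y = 0`; without dilation averaging the side lengths cannot be normalised, only the
plane and the first direction. [cite: Tao2016AveragedNS, §3.2 (3.7) p. 15] -/
def stdTriple (a x y : ℝ) : Fin 3 → ℝ³ := ![!₂[0, a, 0], !₂[-x, -a - y, 0], !₂[x, y, 0]]

/-- The standard triple closes: `ξ 0 + ξ 1 + ξ 2 = 0`. [cite: Tao2016AveragedNS, §3.2 (3.7') p. 16] -/
theorem stdTriple_sum (a x y : ℝ) : stdTriple a x y 0 + stdTriple a x y 1 + stdTriple a x y 2 = 0 := by
  ext i
  fin_cases i <;> simp [stdTriple]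
  ring

/-- Tao's (3.7) is the standard triple `stdTriple 1 1 0`. [cite: Tao2016AveragedNS, §3.2 (3.7) p. 15] -/
theorem stdTriple_one_one_zero : stdTriple 1 1 0 = xi0 := by
  funext j
  ext i
  fin_cases j <;> fin_cases i <;> simp [stdTriple, xi0]

/-- `(0,a,0) = a e₁`. [folklore] -/
private theorem stdTriple_zero_eq (a x y : ℝ) :
    stdTriple a x y 0 = a • EuclideanSpace.single (1 : Fin 3) (1 : ℝ) := by
  ext i
  fin_cases i <;> simp [stdTriple]

/-- `(x,y,0) = x e₀ + y e₁`. [folklore] -/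
private theorem stdTriple_two_eq (a x y : ℝ) :
    stdTriple a x y 2 =
      x • EuclideanSpace.single (0 : Fin 3) (1 : ℝ) + y • EuclideanSpace.single (1 : Fin 3) (1 : ℝ) := by
  ext i
  fin_cases i <;> simp [stdTriple]

/-- `ξ 1 = -ξ 0 - ξ 2` for the standard triple. [folklore] -/
private theorem stdTriple_one_eq (a x y : ℝ) :
    stdTriple a x y 1 = -stdTriple a x y 0 - stdTriple a x y 2 := by
  ext i
  fin_cases i <;> simp [stdTriple]

/-! ### Every closed triple is a rotated standard triple -/

/-- A single unit vector is an orthonormal family on a singleton index set. [folklore] -/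
private theorem orthonormal_restrict_singleton {u : ℝ³} (hu : ‖u‖ = 1) :
    Orthonormal ℝ (({1} : Set (Fin 3)).restrict fun _ : Fin 3 => u) := by
  classical
  rw [orthonormal_iff_ite]
  rintro ⟨i, hi⟩ ⟨j, hj⟩
  simp only [Set.mem_singleton_iff] at hi hj
  subst hi; subst hj
  simp [hu]

/-- The frame `(w, u, w × u)` of two orthogonal unit vectors is orthonormal. [folklore] -/
private theorem orthonormal_frame {w u : ℝ³} (hw : ‖w‖ = 1) (hu : ‖u‖ = 1) (hwu : ⟪w, u⟫ = 0) :
    Orthonormal ℝ ![w, u, cross w u] := by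
  classical
  have hn : ‖cross w u‖ = 1 := by
    have h := norm_cross_sq w u
    rw [hw, hu, hwu] at h
    nlinarith [norm_nonneg (cross w u)]
  have huw : ⟪u, w⟫ = 0 := by rw [real_inner_comm]; exact hwu
  rw [orthonormal_iff_ite]
  intro i j
  fin_cases i <;> fin_cases j <;>
    simp [hw, hu, hwu, huw, hn, inner_self_cross_left, inner_self_cross_right, real_inner_comm]

/-- **Every closed base triple is a rotated standard triple**: if `ξ 0 + ξ 1 + ξ 2 = 0` and
`ξ 0 ≠ 0`, there are a linear isometry `S` of `ℝ³` and `x ≥ 0`, `y` with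
`ξ j = S (stdTriple ‖ξ 0‖ x y j)` for all `j` (`y = ⟪ξ 2, ξ 0/|ξ 0|⟫`, `x` = the norm of the
component of `ξ 2` orthogonal to `ξ 0`; `S` maps `e₁ ↦ ξ 0/|ξ 0|` and, when `x ≠ 0`, `e₀ ↦` that
component normalised). [cite: Tao2016AveragedNS, §3.2 p. 15] -/
theorem exists_linearIsometryEquiv_stdTriple (ξ : Fin 3 → ℝ³) (hsum : ξ 0 + ξ 1 + ξ 2 = 0)
    (h0 : ξ 0 ≠ 0) :
    ∃ (S : ℝ³ ≃ₗᵢ[ℝ] ℝ³) (x y : ℝ), 0 ≤ x ∧ ∀ j, ξ j = S (stdTriple ‖ξ 0‖ x y j) := by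
  classical
  set a : ℝ := ‖ξ 0‖ with ha
  set u : ℝ³ := udir (ξ 0) with hu
  have hu1 : ‖u‖ = 1 := norm_udir h0
  have hξ0 : ξ 0 = a • u := eq_norm_smul_udir h0
  have huu : ⟪u, u⟫ = 1 := by rw [real_inner_self_eq_norm_sq, hu1]; norm_num
  set y : ℝ := ⟪ξ 2, u⟫ with hy
  set r : ℝ³ := ξ 2 - y • u with hr
  have hru : ⟪r, u⟫ = 0 := by
    rw [hr, inner_sub_left, real_inner_smul_left, huu, ← hy]; ring
  have hξ2 : ξ 2 = r + y • u := by rw [hr]; abel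
  have hξ1 : ξ 1 = -ξ 0 - ξ 2 := by
    have : ξ 1 = -(ξ 0) - ξ 2 + (ξ 0 + ξ 1 + ξ 2) := by abel
    rw [this, hsum, add_zero]
  have hcard : finrank ℝ ℝ³ = Fintype.card (Fin 3) := finrank_euclideanSpace
  -- the conclusion for `j = 1` follows from `j = 0, 2`
  have key : ∀ (S : ℝ³ ≃ₗᵢ[ℝ] ℝ³) (x : ℝ), ξ 0 = S (stdTriple a x y 0) → ξ 2 = S (stdTriple a x y 2) →
      ∀ j, ξ j = S (stdTriple a x y j) := by
    intro S x h0' h2' j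
    fin_cases j
    · exact h0'
    · simp only [Fin.mk_one]
      rw [stdTriple_one_eq, map_sub, map_neg, ← h0', ← h2', hξ1]
    · exact h2'
  by_cases hr0 : r = 0
  · -- degenerate case: `ξ 2` parallel to `ξ 0`; any frame containing `u`
    obtain ⟨b, hb⟩ := Orthonormal.exists_orthonormalBasis_extension_of_card_eq hcard
      (orthonormal_restrict_singleton hu1)
    have hb1 : b 1 = u := hb 1 rfl
    refine ⟨b.repr.symm, 0, y, le_rfl, key b.repr.symm 0 ?_ ?_⟩
    · rw [stdTriple_zero_eq, map_smul, b.repr_symm_single, hb1, hξ0]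
    · rw [stdTriple_two_eq, zero_smul, zero_add, map_smul, b.repr_symm_single, hb1, hξ2, hr0,
        zero_add]
  · -- generic case: the frame `(r/|r|, u, r/|r| × u)`
    set w : ℝ³ := udir r with hw
    have hw1 : ‖w‖ = 1 := norm_udir hr0
    have hwu : ⟪w, u⟫ = 0 := by
      rw [hw, udir, real_inner_smul_left, hru, mul_zero]
    have hrw : r = ‖r‖ • w := eq_norm_smul_udir hr0
    have hon := orthonormal_frame hw1 hu1 hwu
    set v : Fin 3 → ℝ³ := ![w, u, cross w u] with hv
    have hsp : ⊤ ≤ Submodule.span ℝ (Set.range v) :=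
      (hon.linearIndependent.span_eq_top_of_card_eq_finrank' hcard.symm).ge
    set b : OrthonormalBasis (Fin 3) ℝ ℝ³ := OrthonormalBasis.mk hon hsp with hbdef
    have hb0 : b 0 = w := by rw [hbdef, OrthonormalBasis.coe_mk]; rfl
    have hb1 : b 1 = u := by rw [hbdef, OrthonormalBasis.coe_mk]; rfl
    refine ⟨b.repr.symm, ‖r‖, y, norm_nonneg _, key b.repr.symm ‖r‖ ?_ ?_⟩
    · rw [stdTriple_zero_eq, map_smul, b.repr_symm_single, hb1, hξ0]
    · rw [stdTriple_two_eq, map_add, map_smul, map_smul, b.repr_symm_single, b.repr_symm_single,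
        hb0, hb1, hξ2, ← hrw]

/-! ### Reduction of the dilation-free single-scale sentence to standard triples -/

/-- **The dilation-free single-scale sentence (3.9) about a closed base triple `ξ` (`ξ 0 ≠ 0`)
follows from the same sentence about its standard representative**: if for every linear isometry
`S`, `x ≥ 0` and `y` with `ξ = S ∘ stdTriple ‖ξ 0‖ x y` the sentence holds about
`stdTriple ‖ξ 0‖ x y`, then it holds about `ξ` (`exists_linearIsometryEquiv_stdTriple` and
`singleScaleAt_isComplexAverageNoDil_rotate`). [cite: Tao2016AveragedNS, §3.2 p. 15 and Remark 3.5 p. 20] -/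
theorem singleScaleAt_isComplexAverageNoDil_of_stdTriple {ξ : Fin 3 → ℝ³} {ε₀ : ℝ}
    (hsum : ξ 0 + ξ 1 + ξ 2 = 0) (h0 : ξ 0 ≠ 0)
    (H : ∀ (S : ℝ³ ≃ₗᵢ[ℝ] ℝ³) (x y : ℝ), 0 ≤ x → (∀ j, ξ j = S (stdTriple ‖ξ 0‖ x y j)) →
      ∀ ψ : Fin 3 → 𝓢(ℝ³, ℂ³), NormalisedProfilesAt (stdTriple ‖ξ 0‖ x y) ε₀ ψ →
        IsComplexAverageNoDilOf (singleScaleForm (ψ 0) (ψ 1) (ψ 2))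
          (betaRhoZeroFormAt (stdTriple ‖ξ 0‖ x y) ε₀))
    (ψ : Fin 3 → 𝓢(ℝ³, ℂ³)) (hψ : NormalisedProfilesAt ξ ε₀ ψ) :
    IsComplexAverageNoDilOf (singleScaleForm (ψ 0) (ψ 1) (ψ 2)) (betaRhoZeroFormAt ξ ε₀) := by
  obtain ⟨S, x, y, hx, hS⟩ := exists_linearIsometryEquiv_stdTriple ξ hsum h0
  have hξ : ξ = fun j => S (stdTriple ‖ξ 0‖ x y j) := funext hS
  have h := singleScaleAt_isComplexAverageNoDil_rotate S (ξ := stdTriple ‖ξ 0‖ x y) (ε₀ := ε₀)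
    (H S x y hx hS) ψ (by rw [← hξ]; exact hψ)
  rw [← hξ] at h
  exact h

end Literature.Analysis.FluidPDE.Tao2016
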